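import Literature.NumberTheory.EllipticCurves.CPMuDescentK3Box
import Literature.NumberTheory.EllipticCurves.ThreeTorsionDescentLocalImageNode
import Literature.NumberTheory.NumberFields.AdicCompletionResidueHom
import HarnessLib

/-!
# The `α̂`-box over `ℚ(√−3)` of the `3`-isogeny descent KILLED at a place where `ζ₃` is not a cubic residue, and
# `t_3(E_{m,s}) = 0` booked from the `α`-box over `ℚ` alone (Cohen–Pazuki 2009, Thm. 2.1 with the local condition
# at a prime `q ∣ s` of the isogenous curve, Prop. 2.2)

Topic `NumberTheory/EllipticCurves`. Sequel of `CPMuDescentK3Box` (crude `K3`-box `⟨[ζ]⟩` from ONE generator) and of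
`ThreeTorsionDescentLocalImageNode` (the local image at a node off `T` lies in `(1 + 𝔪)L*³`). Over `K3 = ℚ(ζ₃)` the
`ℤ/3`-kernel side of the descent of `E = threeTorsionModel m s` is the `μ₃`-descent of the canonical Cohen–Pazuki pair
`V₃ = E_{K3} = cpCurve a₃ b₃ → Ê₃ = threeTorsionModel (mθ₀) (b̂θ₀)` (`b̂ = 3s − 4m³/9`). At a finite place `w₀` of `K3`
with `w₀ ∤ 6N`, `w₀ ∣ s` — a place of multiplicative reduction of `Ê₃` where ITS `3`-torsion point is smooth, since
`27·(b̂θ₀) − 4(mθ₀)³ = 81 s θ₀` — local necessity (`CPMuDescentLocal`) and the node lemma force every `K3`-Selmer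
candidate `u` to be a cube times a `1`-unit in `K3_{w₀}`; the crude box says `[u] = [ζ^i]`; reading the identity
`ζ^i = β³(1 + ε)` in the residue field `𝓞 K3 / w₀` (the tree's `exists_ringHom_adicCompletionIntegers_extending'`)
exhibits an element of order `9` in `(𝓞 K3 / w₀)ˣ` unless `3 ∣ i`. Hence:

* `nine_dvd_card_sub_one_of_pow_three_eq` — in a finite field, a cube root of a non-trivial cube root of unity has
  order `9`, so `9 ∣ #F − 1`;
* `nine_dvd_absNorm_sub_one_of_zetaInt_pow_sub_cube_mem` — `ζ^i ≡ y³ (mod w)`, `3 ∤ i`, `3 ∉ w` ⟹ `9 ∣ N(w) − 1`;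
* `nine_dvd_absNorm_sub_one_of_zeta_pow_eq_cube_mul` — the same read in the completion: `ζ^i = β³(1 + ε)` in
  `K3_w`, `v(ε) < 1`;
* **`torsorClass_eq_zero_of_mem_sha_of_norm_cube_of_nodeKill`** — the `K3`-box statement `hbox` of `CPMuDescentBoxes`
  WITHOUT any generator: inert support `N`, the two valuation conditions off `3N`, and ONE place `w₀ ∤ 3N` with
  `w₀(s₃) = 1`, `w₀(27 s₃ − 4 m₃³) < 1` and `9 ∤ N(w₀) − 1`;
* **`forall_mem_sha_three_nsmul_eq_zero_of_gens_of_nodeKill`**, **`shaCorank_three_eq_zero_of_gens_of_nodeKill`** —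
  `Ш(E/ℚ)[3] = 0`, `t_3(E_{m,s}) = 0` BOOKED from `S` + one `[p] = [α(P)]` per `p ∈ S` (the `α`-box over `ℚ`) and a
  killing place `w₀` over a prime `q ∣ s` (`w₀ ∤ 6N`, `9 ∤ N(w₀) − 1`, i.e. `q ≢ ±1 (mod 9)` inert or `q ≢ 1 (mod 9)`
  split): the shape of the rank-2 census curves with `|S| = 3` and no split prime in `b̂`, e.g. 105490p1, 60180k1.

By local Tate duality this is the statement that the local image of the `ℚ`-side descent of `E` at `q ∣ s` is ALL of
`ℚ_q*/ℚ_q*³` (the rational `3`-torsion point meets the node), so its annihilator on the `K3`-side is trivial; the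
proof here is direct and elementary. Theorems only; no definitions, no named facts.

## References
* [CohenPazuki2009] H. Cohen, F. Pazuki, *Elementary 3-descent with a 3-isogeny*, Acta Arith. 140 (2009), Def. 1.3,
  Thm. 2.1 (local images), Prop. 2.2 (the Selmer/Ш bookkeeping).
* [SilvermanAEC2009] J. H. Silverman, *The Arithmetic of Elliptic Curves*, 2nd ed. (2009), Thm. X.4.2 (a), Prop. X.4.9.
* [IrelandRosen1990] K. Ireland, M. Rosen, *A Classical Introduction to Modern Number Theory*, 2nd ed., GTM 84, Ch. 9
  §1, §3 (cubic residues in `ℤ[ω]`: `ω` is a cube mod `π` iff `9 ∣ Nπ − 1`).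
-/

noncomputable section

open scoped Classical

open WeierstrassCurve IsDedekindDomain IsDedekindDomain.HeightOneSpectrum NumberField

namespace Literature.NumberTheory.EllipticCurves

namespace CPMuDescent

open MordellDescent ThreeTorsionDescent MuThreeKernel WithZero
open Literature.NumberTheory.NumberFields Literature.NumberTheory.NumberFields.K3

/-! ## Cube roots of cube roots of unity in finite fields -/

/-- **In a finite field a cube root of a non-trivial cube root of unity has order `9`; hence `9 ∣ #F − 1`.**
[cite: IrelandRosen1990, Ch. 9 §3 (cubic residue character)] -/
theorem nine_dvd_card_sub_one_of_pow_three_eq {F : Type*} [Field F] [Fintype F] {g c : F}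
    (hg3 : g ^ 3 = 1) (hg1 : g ≠ 1) (hc : c ^ 3 = g) : 9 ∣ Fintype.card F - 1 := by
  have hc0 : c ≠ 0 := by
    rintro rfl
    rw [zero_pow three_ne_zero] at hc
    rw [← hc, zero_pow three_ne_zero] at hg3
    exact zero_ne_one hg3
  set cu : Fˣ := Units.mk0 c hc0 with hcu
  have h9 : cu ^ 9 = 1 := by
    ext
    rw [Units.val_pow_eq_pow_val, Units.val_mk0, Units.val_one, show (9 : ℕ) = 3 * 3 by rfl, pow_mul, hc, hg3]
  have h3 : cu ^ 3 ≠ 1 := by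
    intro h
    apply hg1
    have := congrArg Units.val h
    rwa [Units.val_pow_eq_pow_val, Units.val_mk0, Units.val_one, hc] at this
  have hdvd : orderOf cu ∣ 3 ^ 2 := orderOf_dvd_of_pow_eq_one h9
  obtain ⟨k, hk, hk'⟩ := (Nat.dvd_prime_pow Nat.prime_three).mp hdvd
  have hk2 : k = 2 := by
    interval_cases k
    · exfalso; apply h3
      rw [pow_zero] at hk'
      rw [orderOf_eq_one_iff.mp hk', one_pow]
    · exfalso; apply h3
      rw [pow_one] at hk'
      rw [← hk', pow_orderOf_eq_one]
    · rfl
  rw [hk2] at hk'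
  have h := orderOf_dvd_card (x := cu)
  rw [hk', Fintype.card_units] at h
  exact h

/-! ## `ζ` is a cube modulo `w` only if `9 ∣ N(w) − 1` -/

/-- `(ζ − 1)(ζ² − 1) = 3` in `𝓞 K3`. [cite: IrelandRosen1990, Ch. 9 §1] -/
private theorem zetaInt_sub_one_mul : (zetaInt - 1) * (zetaInt ^ 2 - 1) = (3 : 𝓞 K3) := by
  apply RingOfIntegers.ext
  have h3 : ((3 : 𝓞 K3) : K3) = 3 := by simpa using coe_natCast_ringOfIntegers 3
  rw [h3]
  push_cast [coe_zetaInt]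
  linear_combination (zeta - 2) * zeta_sq

/-- `ζ³ = 1` in `𝓞 K3`. [cite: IrelandRosen1990, Ch. 9 §1] -/
private theorem zetaInt_pow_three : (zetaInt : 𝓞 K3) ^ 3 = 1 := by
  apply RingOfIntegers.ext
  push_cast [coe_zetaInt]
  exact isPrimitiveRoot_zeta.pow_eq_one

/-- `ζ^i − 1 ∉ w` for `3 ∤ i` when `3 ∉ w` (as `(ζ − 1)(ζ² − 1) = 3`). [cite: IrelandRosen1990, Ch. 9 §1] -/
private theorem zetaInt_pow_sub_one_not_mem {w : HeightOneSpectrum (𝓞 K3)} (h3 : (3 : 𝓞 K3) ∉ w.asIdeal)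
    {i : ℕ} (hi : ¬ 3 ∣ i) : zetaInt ^ i - 1 ∉ w.asIdeal := by
  have hmod : zetaInt ^ i = zetaInt ^ (i % 3) := by
    conv_lhs => rw [← Nat.div_add_mod i 3, pow_add, pow_mul, zetaInt_pow_three, one_pow, one_mul]
  rw [hmod]
  intro hmem
  apply h3
  rw [← zetaInt_sub_one_mul]
  have hi' : i % 3 = 1 ∨ i % 3 = 2 := by omega
  rcases hi' with h1 | h2
  · rw [h1, pow_one] at hmem
    exact w.asIdeal.mul_mem_right _ hmem
  · rw [h2] at hmem
    exact w.asIdeal.mul_mem_left _ hmem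

/-- **`ζ^i ≡ y³ (mod w)` with `3 ∤ i` and `3 ∉ w` forces `9 ∣ N(w) − 1`**: in the residue field `𝓞 K3 / w` the
class of `y` has order `9`. [cite: IrelandRosen1990, Ch. 9 §3 (cubic residue character)] -/
theorem nine_dvd_absNorm_sub_one_of_zetaInt_pow_sub_cube_mem {w : HeightOneSpectrum (𝓞 K3)}
    (h3 : (3 : 𝓞 K3) ∉ w.asIdeal) {i : ℕ} (hi : ¬ 3 ∣ i) {y : 𝓞 K3}
    (h : zetaInt ^ i - y ^ 3 ∈ w.asIdeal) : 9 ∣ Ideal.absNorm w.asIdeal - 1 := by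
  haveI : w.asIdeal.IsMaximal := w.isMaximal
  letI : Field (𝓞 K3 ⧸ w.asIdeal) := Ideal.Quotient.field w.asIdeal
  haveI : Finite (𝓞 K3 ⧸ w.asIdeal) := Ideal.finiteQuotientOfFreeOfNeBot w.asIdeal w.ne_bot
  letI : Fintype (𝓞 K3 ⧸ w.asIdeal) := Fintype.ofFinite _
  have hcard : Ideal.absNorm w.asIdeal = Fintype.card (𝓞 K3 ⧸ w.asIdeal) := by
    rw [Ideal.absNorm_apply, Submodule.cardQuot_apply, Nat.card_eq_fintype_card]
  rw [hcard]
  refine nine_dvd_card_sub_one_of_pow_three_eq (g := Ideal.Quotient.mk w.asIdeal (zetaInt ^ i))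
    (c := Ideal.Quotient.mk w.asIdeal y) ?_ ?_ ?_
  · rw [← map_pow, ← pow_mul, mul_comm, pow_mul, zetaInt_pow_three, one_pow, map_one]
  · intro h1
    rw [← map_one (Ideal.Quotient.mk w.asIdeal), Ideal.Quotient.eq] at h1
    exact zetaInt_pow_sub_one_not_mem h3 hi h1
  · rw [← map_pow, eq_comm, Ideal.Quotient.eq]
    exact h

/-- **The same read in the completion `K3_w`**: if `ζ^i = β³ (1 + ε)` in `K3_w` with `v(ε) < 1`, `3 ∤ i`, `3 ∉ w`,
then `9 ∣ N(w) − 1` (pass to `O_w`, then to `𝓞 K3 / w` by the residue map extending the quotient map).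
[cite: IrelandRosen1990, Ch. 9 §3] [cite: SilvermanAEC2009, Prop. X.4.9] -/
theorem nine_dvd_absNorm_sub_one_of_zeta_pow_eq_cube_mul (w : HeightOneSpectrum (𝓞 K3))
    (h3 : (3 : 𝓞 K3) ∉ w.asIdeal) {i : ℕ} (hi : ¬ 3 ∣ i) {β ε : w.adicCompletion K3}
    (hε : Valued.v ε < 1) (h : (algebraMap K3 (w.adicCompletion K3) zeta) ^ i = β ^ 3 * (1 + ε)) :
    9 ∣ Ideal.absNorm w.asIdeal - 1 := by
  -- valuations: `ζ` and `β` are units of `O_w`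
  have hζv : Valued.v (algebraMap K3 (w.adicCompletion K3) zeta) = 1 := by
    have e : Valued.v (algebraMap K3 (w.adicCompletion K3) zeta) ^ 3 = 1 := by
      rw [← map_pow, ← map_pow, isPrimitiveRoot_zeta.pow_eq_one, map_one, map_one]
    exact (pow_eq_one_iff.mp e).resolve_right three_ne_zero
  have h1ε : Valued.v (1 + ε) = 1 := Valued.v.map_one_add_of_lt hε
  have hβ : Valued.v β = 1 := by
    have e : Valued.v β ^ 3 = 1 := by
      have := congrArg Valued.v h
      rw [map_pow, hζv, one_pow, map_mul, map_pow, h1ε, mul_one] at this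
      exact this.symm
    exact (pow_eq_one_iff.mp e).resolve_right three_ne_zero
  -- lift to `O_w`
  set O := w.adicCompletionIntegers K3 with hO
  let βO : O := ⟨β, (mem_adicCompletionIntegers (𝓞 K3) K3 w).mpr hβ.le⟩
  let εO : O := ⟨ε, (mem_adicCompletionIntegers (𝓞 K3) K3 w).mpr hε.le⟩
  let ζO : O := algebraMap (𝓞 K3) O zetaInt
  have hζO : (ζO : w.adicCompletion K3) = algebraMap K3 (w.adicCompletion K3) zeta := by
    rw [Literature.NumberTheory.NumberFields.coe_algebraMap_adicCompletionIntegers_eq K3 w zetaInt]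
    rfl
  have hid : ζO ^ i = βO ^ 3 * (1 + εO) := by
    apply Subtype.ext
    push_cast
    rw [hζO]
    exact h
  -- residue map extending `𝓞 K3 → 𝓞 K3 / w`
  obtain ⟨ρ, hρ, hker⟩ := Literature.NumberTheory.NumberFields.exists_ringHom_adicCompletionIntegers_extending' K3 w
    (Ideal.Quotient.mk w.asIdeal) Ideal.Quotient.mk_surjective Ideal.mk_ker
  have hρε : ρ εO = 0 := (hker εO).mpr hε
  obtain ⟨y, hy⟩ := Ideal.Quotient.mk_surjective (ρ βO)
  have hres : Ideal.Quotient.mk w.asIdeal (zetaInt ^ i) = Ideal.Quotient.mk w.asIdeal (y ^ 3) := by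
    rw [map_pow, map_pow, ← hρ zetaInt, hy, ← map_pow, ← map_pow ρ, show
      (algebraMap (𝓞 K3) O zetaInt) ^ i = ζO ^ i from rfl, hid, map_mul, map_add, map_one, hρε, add_zero, mul_one]
  exact nine_dvd_absNorm_sub_one_of_zetaInt_pow_sub_cube_mem h3 hi (Ideal.Quotient.eq.mp hres)

/-! ## The `K3`-box killed at a node of `Ê₃` -/

/-- **The `α̂`-box over `K3` with NO generator, killed at one place.** For a Cohen–Pazuki pair
`cpCurve a₃ b₃ → threeTorsionModel m₃ s₃` over `K3` (`t m₃ = 3a₃`, `t³ s₃ = 4a₃³ + 9b₃`), an `N ≠ 0` whose prime factors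
are `2` or `≡ 2 (mod 3)` with `w(2s₃) = 1`, `w(2m₃) ≤ 1` at every `w ∌ 3N`, and ONE place `w₀ ∌ 3N` with `w₀(2) = 1`,
`w₀(s₃) = 1`, `w₀(27 s₃ − 4 m₃³) < 1` (a node of `Ê₃` off its `3`-torsion point) and `9 ∤ N(w₀) − 1` (`ζ` is not a
cube modulo `w₀`): every `μ₃`-torsor class `[C_u]`, `u` of cube norm, lying in `Ш(V₃/K3)` vanishes.
[cite: CohenPazuki2009, Theorem 2.1 and Proposition 2.2] [cite: SilvermanAEC2009, Prop. X.4.9] -/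
theorem torsorClass_eq_zero_of_mem_sha_of_norm_cube_of_nodeKill {N : ℕ} (hN0 : N ≠ 0)
    (hN : ∀ q ∈ N.primeFactors, q = 2 ∨ q % 3 = 2) {a₃ b₃ t m₃ s₃ : K3} (hb₃ : b₃ ≠ 0)
    (hd₃ : 4 * a₃ ^ 3 + 9 * b₃ ≠ 0) (ht : t ≠ 0) (hm₃ : t * m₃ = 3 * a₃) (hs₃ : t ^ 3 * s₃ = 4 * a₃ ^ 3 + 9 * b₃)
    (hvs : ∀ w : HeightOneSpectrum (𝓞 K3), ((3 * N : ℕ) : 𝓞 K3) ∉ w.asIdeal → w.valuation K3 (2 * s₃) = 1)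
    (hvm : ∀ w : HeightOneSpectrum (𝓞 K3), ((3 * N : ℕ) : 𝓞 K3) ∉ w.asIdeal → w.valuation K3 (2 * m₃) ≤ 1)
    (w₀ : HeightOneSpectrum (𝓞 K3)) (hw₀ : ((3 * N : ℕ) : 𝓞 K3) ∉ w₀.asIdeal) (hw₀2 : w₀.valuation K3 2 = 1)
    (hw₀s : w₀.valuation K3 s₃ = 1) (hw₀D : w₀.valuation K3 (27 * s₃ - 4 * m₃ ^ 3) < 1)
    (hw₀9 : ¬ 9 ∣ Ideal.absNorm w₀.asIdeal - 1)
    {u : K3} (hu : u ≠ 0) (hsha : (kernelDatum hb₃ hd₃).torsorClass hu ∈ (cpCurve a₃ b₃).sha)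
    (hnorm : ∃ r : ℚ, QuadraticAlgebra.norm u = r ^ 3) : (kernelDatum hb₃ hd₃).torsorClass hu = 0 := by
  -- the crude box: `[u] = [ζ^i]`
  have hval : ∀ w : HeightOneSpectrum (𝓞 K3), ((3 * N : ℕ) : 𝓞 K3) ∉ w.asIdeal →
      (3 : ℤ) ∣ log (w.valuation K3 u) := by
    intro w hw
    obtain ⟨P, w', e, hw', hP⟩ :=
      exists_descent_pow_eq_adicCompletion_of_torsorClass_mem_sha hb₃ hd₃ ht hm₃ hs₃ hu hsha w
    have hval' : ∀ x : K3, Valued.v (algebraMap K3 (w.adicCompletion K3) x) = w.valuation K3 x :=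
      fun x => valuedAdicCompletion_eq_valuation' w x
    have key := Carrier6137.three_dvd_log_of_descent_pow_eq' Valued.v (algebraMap K3 (w.adicCompletion K3))
      (by rw [hval']; exact hvs w hw) (by rw [hval']; exact hvm w hw) hu hw' hP
    rwa [hval'] at key
  obtain ⟨i, hi3, hi⟩ := K3.exists_cubeClass_eq_zeta_pow_of_norm_cube_inert hN0 hN hu hval hnorm
  have hz : (zeta : K3) ≠ 0 := isPrimitiveRoot_zeta.ne_zero (by norm_num)
  -- either `i = 0` (done) or `3 ∤ i` (killed at `w₀`)
  by_cases hi0 : i = 0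
  · rw [(kernelDatum hb₃ hd₃).torsorClass_eq_zero_iff_cubeClass_mem_ker hu, hi, hi0, pow_zero, cubeClass_one]
    exact one_mem _
  · exfalso
    have hi' : ¬ 3 ∣ i := by omega
    -- `u = ζ^i r³`
    obtain ⟨r, hr, hur⟩ := (cubeClass_eq_cubeClass_iff hu (pow_ne_zero i hz)).mp hi
    -- local necessity at `w₀` and the node lemma: `u = c³ (1 + ε)` in `K3_{w₀}`
    set L := w₀.adicCompletion K3 with hL
    set φ := algebraMap K3 L with hφ
    have hval' : ∀ x : K3, Valued.v (φ x) = w₀.valuation K3 x := fun x => valuedAdicCompletion_eq_valuation' w₀ x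
    obtain ⟨P, w', e, hw', hP⟩ :=
      exists_descent_pow_eq_adicCompletion_of_torsorClass_mem_sha hb₃ hd₃ ht hm₃ hs₃ hu hsha w₀
    have hw₀3 : (3 : 𝓞 K3) ∉ w₀.asIdeal := fun h => hw₀ (by
      rw [Nat.cast_mul, Nat.cast_ofNat]; exact w₀.asIdeal.mul_mem_right _ h)
    have h3' : w₀.valuation K3 (3 : K3) = 1 := by
      have h33 : ((3 : 𝓞 K3) : K3) = 3 := by simpa using coe_natCast_ringOfIntegers 3
      rw [← h33]
      exact K3.valuation_coe_eq_one w₀ hw₀3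
    have h2L : Valued.v (2 : L) = 1 := by rw [← map_ofNat φ 2, hval']; exact hw₀2
    have h3L : Valued.v (3 : L) = 1 := by rw [← map_ofNat φ 3, hval']; exact h3'
    have hsL : Valued.v (φ s₃) = 1 := by rw [hval']; exact hw₀s
    have hDL : Valued.v (27 * φ s₃ - 4 * φ m₃ ^ 3) < 1 := by
      rw [show (27 : L) * φ s₃ - 4 * φ m₃ ^ 3 = φ (27 * s₃ - 4 * m₃ ^ 3) by
        rw [map_sub, map_mul, map_mul, map_pow, map_ofNat, map_ofNat], hval']
      exact hw₀D
    obtain ⟨c, ε, -, hε, huc⟩ := (Valued.v : Valuation L ℤᵐ⁰).eq_cube_mul_one_add_of_threeTorsionDescent_pow_eq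
      (W := threeTorsionModel (φ m₃) (φ s₃)) rfl h2L h3L hsL hDL hw' hP
    have hr' : φ r ≠ 0 := (map_ne_zero φ).mpr hr
    have hζ : (algebraMap K3 L zeta) ^ i = (c / φ r) ^ 3 * (1 + ε) := by
      rw [hur, map_mul, map_pow, map_pow] at huc
      rw [div_pow, div_mul_eq_mul_div, eq_div_iff (pow_ne_zero 3 hr')]
      linear_combination huc
    exact hw₀9 (nine_dvd_absNorm_sub_one_of_zeta_pow_eq_cube_mul w₀ hw₀3 hi' hε hζ)

/-! ## The canonical pair of `E_{m,s}` at the killing place -/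

section Canonical

variable {m s : ℚ} {θ₀ : K3} (hθ : θ₀ ^ 2 = -3)
include hθ

/-- `w(s₃) = w(b̂θ₀) = 1` at `w ∌ 3N` from `w(2b̂) = 1` and `w(2) = 1`. [cite: CohenPazuki2009, Theorem 2.1 (2)] -/
theorem canonical₃_valuation_s₃ {N : ℕ} {w : HeightOneSpectrum (𝓞 K3)} (hw : ((3 * N : ℕ) : 𝓞 K3) ∉ w.asIdeal)
    (h2 : w.valuation K3 2 = 1) (hvb : w.valuation K3 (algebraMap ℚ K3 (2 * (3 * s - 4 * m ^ 3 / 9))) = 1) :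
    w.valuation K3 (algebraMap ℚ K3 (3 * s - 4 * m ^ 3 / 9) * θ₀) = 1 := by
  have h := canonical₃_valuation_s hθ hw hvb
  rw [Valuation.map_mul, h2, one_mul] at h
  exact h

/-- `27 s₃ − 4 m₃³ = 81 s θ₀` for `(m₃, s₃) = (mθ₀, b̂θ₀)`: the killing place `w ∣ s`, `w ∤ 3N` is a NODE of `Ê₃` off its
`3`-torsion point, `w(27 s₃ − 4 m₃³) < 1`. [cite: CohenPazuki2009, Theorem 2.1] -/
theorem canonical₃_valuation_D {N : ℕ} {w : HeightOneSpectrum (𝓞 K3)} (hw : ((3 * N : ℕ) : 𝓞 K3) ∉ w.asIdeal)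
    (hws : w.valuation K3 (algebraMap ℚ K3 s) < 1) :
    w.valuation K3 (27 * (algebraMap ℚ K3 (3 * s - 4 * m ^ 3 / 9) * θ₀) - 4 * (algebraMap ℚ K3 m * θ₀) ^ 3) < 1 := by
  have e : 27 * (algebraMap ℚ K3 (3 * s - 4 * m ^ 3 / 9) * θ₀) - 4 * (algebraMap ℚ K3 m * θ₀) ^ 3 =
      ((81 : ℕ) : K3) * algebraMap ℚ K3 s * θ₀ := by
    rw [map_sub, map_mul, map_div₀, map_mul, map_pow, map_ofNat, map_ofNat, map_ofNat, Nat.cast_ofNat]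
    linear_combination (-4 * (algebraMap ℚ K3 m) ^ 3 * θ₀) * hθ
  have h81 : w.valuation K3 ((81 : ℕ) : K3) = 1 :=
    valuation_natCast_eq_one_of_dvd_pow hw (A := 81) (k := 4) (Dvd.intro (N ^ 4) (by ring))
  rw [e, Valuation.map_mul, Valuation.map_mul, valuation_theta0_eq_one_of_not_mem hθ hw, h81, mul_one, one_mul]
  exact hws

end Canonical

/-! ## Booking a cross-prime cell at `3`: the `α`-box over `ℚ` and a killing place over `q ∣ s` -/

/-- **`Ш(E/ℚ)[3] = 0` for `E = threeTorsionModel m s` from the `α`-box over `ℚ` and ONE killing place.** Inputs: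
(ℚ-side) a finite set of primes `S` outside which `v_p(2s) = 0 ≤ v_p(2m)`, and `[p] ∈ ⟨[α(P)] : P ∈ E(ℚ)⟩` for every
`p ∈ S`; (`K3`-side) `N ≠ 0` with inert prime factors such that `w(2b̂) = 1`, `w(2m) ≤ 1` at every `w ∌ 3N`
(`b̂ = 3s − 4m³/9`), and a place `w₀ ∌ 3N` with `w₀(2) = 1`, `w₀(s) < 1` and `9 ∤ N(w₀) − 1` — e.g. `w₀ = (q)` for an inert
prime `q ∣ s`, `q ∤ 6N`, `q ≢ ±1 (mod 9)`. No point over `ℚ(√−3)` is needed: the `α̂`-box `⟨[ζ]⟩` dies at `w₀`.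
[cite: CohenPazuki2009, Theorem 2.1 and Proposition 2.2] [cite: SilvermanAEC2009, Thm. X.4.2 (a)] -/
theorem forall_mem_sha_three_nsmul_eq_zero_of_gens_of_nodeKill {m s : ℚ} [(threeTorsionModel m s).IsElliptic]
    (S : Finset ℕ) (hS : ∀ p ∈ S, p.Prime)
    (hout : ∀ p : ℕ, p.Prime → p ∉ S → padicValRat p (2 * s) = 0 ∧ 0 ≤ padicValRat p (2 * m))
    (hgen : ∀ p ∈ S, cubeClass (p : ℚ) ∈ Subgroup.closure (Set.range
      fun P : (threeTorsionModel m s).toAffine.Point => descentClass (threeTorsionModel m s) m s P))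
    {N : ℕ} (hN0 : N ≠ 0) (hN : ∀ q ∈ N.primeFactors, q = 2 ∨ q % 3 = 2)
    (hvb : ∀ w : HeightOneSpectrum (𝓞 K3), ((3 * N : ℕ) : 𝓞 K3) ∉ w.asIdeal →
      w.valuation K3 (algebraMap ℚ K3 (2 * (3 * s - 4 * m ^ 3 / 9))) = 1)
    (hvm : ∀ w : HeightOneSpectrum (𝓞 K3), ((3 * N : ℕ) : 𝓞 K3) ∉ w.asIdeal →
      w.valuation K3 (algebraMap ℚ K3 (2 * m)) ≤ 1)
    (w₀ : HeightOneSpectrum (𝓞 K3)) (hw₀ : ((3 * N : ℕ) : 𝓞 K3) ∉ w₀.asIdeal) (hw₀2 : w₀.valuation K3 2 = 1)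
    (hw₀s : w₀.valuation K3 (algebraMap ℚ K3 s) < 1) (hw₀9 : ¬ 9 ∣ Ideal.absNorm w₀.asIdeal - 1) :
    ∀ c ∈ (threeTorsionModel m s).sha, 3 • c = 0 → c = 0 :=
  forall_mem_sha_three_nsmul_eq_zero_of_gens_of_box S hS hout hgen
    (fun θ₀ => -(algebraMap ℚ K3 m / 3) * θ₀) (fun θ₀ => -(algebraMap ℚ K3 s / 3) * θ₀)
    (fun _ hθ => canonical₃_b_ne_zero (m := m) hθ) (fun _ hθ => canonical₃_d_ne_zero hθ)
    (fun _ hθ => canonical₃_baseChange_eq hθ) (fun _ hθ => canonical₃_hy hθ)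
    (fun θ₀ hθ _ hu hsha hnorm => torsorClass_eq_zero_of_mem_sha_of_norm_cube_of_nodeKill hN0 hN
      (canonical₃_b_ne_zero (m := m) hθ) (canonical₃_d_ne_zero hθ) (t := -1) (by norm_num) canonical₃_hm
      (canonical₃_hs hθ) (fun w hw => canonical₃_valuation_s hθ hw (hvb w hw))
      (fun w hw => canonical₃_valuation_m hθ hw (hvm w hw)) w₀ hw₀ hw₀2
      (canonical₃_valuation_s₃ hθ hw₀ hw₀2 (hvb w₀ hw₀)) (canonical₃_valuation_D hθ hw₀ hw₀s) hw₀9 hu hsha hnorm)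

/-- **`t_3(E_{m,s}) = corank_{ℤ₃} Ш(E/ℚ)[3^∞] = 0` BOOKED from the `α`-box over `ℚ` and a killing place** (the
`α̂`-box over `ℚ(√−3)` needs no generator). [cite: CohenPazuki2009, Proposition 2.2] [cite: SilvermanAEC2009, Thm. X.4.2 (a)] -/
theorem shaCorank_three_eq_zero_of_gens_of_nodeKill {m s : ℚ} [(threeTorsionModel m s).IsElliptic]
    (S : Finset ℕ) (hS : ∀ p ∈ S, p.Prime)
    (hout : ∀ p : ℕ, p.Prime → p ∉ S → padicValRat p (2 * s) = 0 ∧ 0 ≤ padicValRat p (2 * m))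
    (hgen : ∀ p ∈ S, cubeClass (p : ℚ) ∈ Subgroup.closure (Set.range
      fun P : (threeTorsionModel m s).toAffine.Point => descentClass (threeTorsionModel m s) m s P))
    {N : ℕ} (hN0 : N ≠ 0) (hN : ∀ q ∈ N.primeFactors, q = 2 ∨ q % 3 = 2)
    (hvb : ∀ w : HeightOneSpectrum (𝓞 K3), ((3 * N : ℕ) : 𝓞 K3) ∉ w.asIdeal →
      w.valuation K3 (algebraMap ℚ K3 (2 * (3 * s - 4 * m ^ 3 / 9))) = 1)
    (hvm : ∀ w : HeightOneSpectrum (𝓞 K3), ((3 * N : ℕ) : 𝓞 K3) ∉ w.asIdeal →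
      w.valuation K3 (algebraMap ℚ K3 (2 * m)) ≤ 1)
    (w₀ : HeightOneSpectrum (𝓞 K3)) (hw₀ : ((3 * N : ℕ) : 𝓞 K3) ∉ w₀.asIdeal) (hw₀2 : w₀.valuation K3 2 = 1)
    (hw₀s : w₀.valuation K3 (algebraMap ℚ K3 s) < 1) (hw₀9 : ¬ 9 ∣ Ideal.absNorm w₀.asIdeal - 1) :
    (threeTorsionModel m s).shaCorank 3 = 0 :=
  haveI : Fact (Nat.Prime 3) := ⟨Nat.prime_three⟩
  shaCorank_eq_zero_of_forall _ 3
    (forall_mem_sha_three_nsmul_eq_zero_of_gens_of_nodeKill S hS hout hgen hN0 hN hvb hvm w₀ hw₀ hw₀2 hw₀s hw₀9)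

end CPMuDescent

end Literature.NumberTheory.EllipticCurves

end
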